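import Mathlib
import Summits.Ventures.PercRepro2.CoinTreeCore
import Summits.Ventures.PercRepro2.CoinOrTailKDefs
import Summits.Ventures.PercRepro2.CoinKSureMarkerB

/-!
# A marker at a second OR-vertex: an instantiation (blind cell PercRepro2, night-2 g15;
NIGHT2-DARC.md §53)

A coin system on `Fin 10` (s = 0, m = 1, r₁ = 2, r₂ = 3, q₁ = 4, q₂ = 5, a = 6, b = 7, w = 8,
t = 9): the out-tree core `s → {m, r₁, r₂, q₁, q₂}`, the OR-tail `a` entered from `r₁, r₂`
(coins 5, 6), a SECOND OR-vertex `b` entered from `q₁, q₂` (coins 7, 8), the head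
`a → t`, `b → t`, `w → t`, `b → w`, `m → w`.  Row 2′DARC at `a → w` for the markers `(m, b)` — the
second marker sits at the OR-vertex `b` of the head — for every probability vector whose four
entry coins are sure (`darc_markerB_example`), by `darc_of_orTailKSure_markerB`.
-/

namespace Summit.Ventures.PercRepro2.Coin

namespace MarkerBExample

open Classical

/-- The fourteen coins of the example. -/
def arcsMB : Fin 14 → Finset (Fin 10 × Fin 10)
  | 0 => {(0, 1)}   -- s → m
  | 1 => {(0, 2)}   -- s → r₁
  | 2 => {(0, 3)}   -- s → r₂
  | 3 => {(0, 4)}   -- s → q₁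
  | 4 => {(0, 5)}   -- s → q₂
  | 5 => {(2, 6)}   -- r₁ → a  (sure)
  | 6 => {(3, 6)}   -- r₂ → a  (sure)
  | 7 => {(4, 7)}   -- q₁ → b  (sure)
  | 8 => {(5, 7)}   -- q₂ → b  (sure)
  | 9 => {(6, 9)}   -- a → t
  | 10 => {(7, 9)}  -- b → t
  | 11 => {(8, 9)}  -- w → t
  | 12 => {(7, 8)}  -- b → w
  | 13 => {(1, 8)}  -- m → w

/-- The entry coins of `a`: `c r₁ = 5`, `c r₂ = 6`. -/
def cMB : Fin 10 → Fin 14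
  | 2 => 5
  | 3 => 6
  | _ => 0

/-- The entry coins of `b`: `d q₁ = 7`, `d q₂ = 8`. -/
def dMB : Fin 10 → Fin 14
  | 4 => 7
  | 5 => 8
  | _ => 0

/-- The tree coins. -/
def tcMB : Fin 10 → Fin 14
  | 1 => 0
  | 2 => 1
  | 3 => 2
  | 4 => 3
  | 5 => 4
  | _ => 0

/-- The parent map (every core vertex is a child of `s`). -/
def parMB : Fin 10 → Fin 10 := fun _ => 0

/-- The rank. -/
def rkMB : Fin 10 → ℕ
  | 1 => 1
  | 2 => 1
  | 3 => 1
  | 4 => 1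
  | 5 => 1
  | _ => 0

/-- Every coin is a single arc, so `SameEnds` holds. -/
lemma sameEnds_mb : SameEnds arcsMB := by
  intro e xy hxy x'y' hx'y'
  fin_cases e <;> simp [arcsMB] at hxy hx'y' <;> subst hxy <;> subst hx'y' <;>
    exact ⟨Or.inl rfl, Or.inr rfl⟩

set_option maxRecDepth 20000 in
/-- `{m, r₁, r₂, q₁, q₂}` is an out-tree core of `s`. -/
lemma treeCore_mb : TreeCore arcsMB 0 {1, 2, 3, 4, 5} tcMB parMB rkMB where
  tree := by decide
  par_mem := by decide
  rank := by decide
  into_C := by decide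
  into_s := by decide
  s_notin := by decide

set_option maxRecDepth 20000 in
/-- The tail `a = 6` entered from `r₁, r₂` is an OR-tail of the core. -/
lemma orTailK_mb : OrTailK arcsMB 0 {1, 2, 3, 4, 5} {2, 3} cMB 6 where
  ent_sub := by decide
  s_notin := by decide
  a_notin := by decide
  a_ne_s := by decide
  into_U := by decide
  into_s := by decide
  into_a := by decide
  arcs_c := by decide
  c_inj := by decide

set_option maxRecDepth 20000 in
/-- The second OR-vertex `b = 7` entered from `q₁, q₂` is an OR-tail of the core `U ∪ {a}`. -/
lemma orTailKb_mb : OrTailK arcsMB 0 (insert 6 {1, 2, 3, 4, 5}) {4, 5} dMB 7 where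
  ent_sub := by decide
  s_notin := by decide
  a_notin := by decide
  a_ne_s := by decide
  into_U := by decide
  into_s := by decide
  into_a := by decide
  arcs_c := by decide
  c_inj := by decide

/-- **Row 2′DARC at `a → w` for the markers `(m, b)` — the second marker at the OR-vertex `b`
of the head — for every probability vector whose four entry coins are sure.** -/
theorem darc_markerB_example {R : Type*} [Field R] [LinearOrder R] [IsStrictOrderedRing R]
    (pr : Fin 14 → R) (hp : IsProbVec pr) (h5 : pr 5 = 1) (h6 : pr 6 = 1) (h7 : pr 7 = 1)
    (h8 : pr 8 = 1) :
    DARC pr arcsMB 0 {9} 1 7 6 8 := by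
  have hsure : ∀ r ∈ ({2, 3} : Finset (Fin 10)), pr (cMB r) = 1 := by
    intro r hr
    simp only [Finset.mem_insert, Finset.mem_singleton] at hr
    rcases hr with rfl | rfl
    · exact h5
    · exact h6
  have hsureb : ∀ r ∈ ({4, 5} : Finset (Fin 10)), pr (dMB r) = 1 := by
    intro r hr
    simp only [Finset.mem_insert, Finset.mem_singleton] at hr
    rcases hr with rfl | rfl
    · exact h7
    · exact h8
  exact darc_of_orTailKSure_markerB pr hp sameEnds_mb orTailK_mb orTailKb_mb (by decide)
    (by decide) hsure hsureb (treeCore_mb.coreLevel_lsm pr hp) (by decide) (by decide) (by decide)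
    (by decide)

end MarkerBExample

end Summit.Ventures.PercRepro2.Coin
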